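import Summits.QuantumFields.BalabanUV.T4Continuum.Support.VariationalCovariantTwoRunsTransport
import Summits.QuantumFields.BalabanUV.T4Continuum.Support.VariationalCovariantTwoRunsNE3
import Summits.QuantumFields.BalabanUV.T4Continuum.Support.VariationalTaxiNestedTower

/-!
# T⁴ programme, spine node NE2 (U1a), lane P2 — SUPPLIER ITEM (O2″) «THE TWO-RUNS TAXI END», file 1 of 2: the NESTED-vs-STRAIGHT relative
# phase of the nested taxi transport OF A LEVEL-`k` CONNECTION (`nestOf`, this lineage's p216054) from ONE scale-invariant plaquette bound,
# and the run-`k` reference data (in-block defect, fictitious defect, per-block smallness) at taxi data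

NE2 formalisation swarm `b2b-balaban-t4-ne2-formalise-*`, leaf prover 09 (gen 5); register row «P2-sup» of `t4/formal/NE2/LEAVES.md`.  After (O2′)
(p216054 ∕ p216264 ∕ p216365 ∕ p216490: node U1b's `LocalRate` ⟹ the two-run CLASS of the road owner's two-runs ENDs p215328 ∕ p215541) the
frame-free END `VariationalCovariantTwoRunsSocketLocal.towerLimitRate_twoRuns_of_localRate_local_nest` still DISPLAYS the transport binders of
the canonical objects (`nestOf`, `taxiT`, `coarseT ∘ fineOf`).  leaf-04-g3's (O7) `VariationalTaxiTower(EndLocal)` discharges all PAIR-side binders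
level by level from the plaquette defect of the one-step phases — those lemmas need no coherence and apply verbatim with `R′ := fun k => fineOf L M Rc k`;
what they do NOT give for two runs is the relative phase `hrel` (leaf-01-g4's (O10) `tower_hrel` is stated along ONE coherent tower) and the
run-`k` side (UB⁺ ∕ P⁺ in leaf shape for `(Rc k, nestOf k (Rc k))`).  THIS FILE supplies exactly these:
 * §1 `plaq_pres` ∕ `norm_plaq_fineOf_sub_one_le` — plaquettes of the one-step presentation are the level-`k+1` plaquettes (leaf-01-g4's `plaq_Rtr`
   + this lineage's `Rtr_pres`); `lev_mul_L` (the cast identity `(L^k)·L = L^{k+1}` behind the class line `((L^k)·L)²·p_{k+1} = (L^{k+1})²·p_{k+1}`);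
 * §2 **`nestOf_hrel_geom`** ∕ **`nestOf_hrel`** — for unit level-`k` phases `R` with plaquette defect `a` and `(L^k)²·a ≤ c`:
   `‖nestOf k R x · conj (taxiT (L^k) M R x) − 1‖ ≤ 4d²·c·(1 − L^{−k}) ≤ 4d²·c` (induction over the nesting with leaf-01-g4's one-level
   `VariationalTaxiNested.norm_compT_rel_step` + `step_le_of_class` and leaf-04-g3's `plaq_coarseT_sub_one_le`: the coarsened phases keep the
   class constant `c` EXACTLY — curvature is scale-invariant);
 * §3 the RUN-`k` REFERENCE DATA at taxi data: `hwin_run` (in-block defect `w₀_k = (d−1)(L^k − 1)·p_k` of `(Rc k, taxiT (Rc k))`, leaf-04-g2's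
   `inBlock_defect_taxiT_le`), `n_mul_w₀_le` (`n·w₀_k ≤ (d−1)c`), `hw'_run` (the fictitious-defect line with the SAME `w′_k = c_w′∕L^k`,
   `c_w′ = (4 + (d−1)c)∕(1−γ)` as the pair side), `hsmall_run` (`2d((d−1)c)² + 4γ² ≤ ½ ⇒ 2d(n·w₀_k)² + 4γ² ≤ ½`).
File 2 (`VariationalCovariantTwoRunsTaxiEnd`) assembles the frame-free two-runs END with NO displayed transport binder.

HONEST FRAMING (T4-DAG p. 1).  Model level (U(1) phases, abelian taxi ∕ straight contours = DATA; [Balaban1985BackgroundPropagators] (3.15) ∕ (3.19)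
p.393 SHAPES only; no B0); elementary, [folklore]; nothing printed is a hypothesis; no `def`; no `def … : Prop`; no `sorry`; axioms standard.  NE3 OPEN;
NE2 NOT proved; spine PROVED 0∕9 unchanged; rung (B)+1 finite T⁴ — NOT infinite volume, NOT a mass gap, NOT Clay.  HONEST DEPENDENCY (cell, verbatim):
continuum YM on T⁴ ⇐ BetaPertH ∧ nine spine estimates (0/9 proved); BetaPertH ⇐ (D1) ∧ (D4) ∧ CAP+tail; G-an2-4 gates asym, D1 and NE2/3/4.
-/

noncomputable section

open scoped BigOperators ComplexConjugate
open Finset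

namespace Summit.QuantumFields.BalabanUV.T4Continuum.VariationalCovariantTwoRunsNestRel

open Literature.MathematicalPhysics.QuantumFieldTheory.Balaban1983to89.B5Prop11Plancherel (Tor fine unitVec)
open Literature.MathematicalPhysics.QuantumFieldTheory.Balaban1983to89.B5Block118 (bpt)
open Literature.MathematicalPhysics.QuantumFieldTheory.Balaban1983to89.B5Composition116 (sites)
open Summit.QuantumFields.BalabanUV.T4Continuum.VariationalCovariantTower (compT Rtr)
open Summit.QuantumFields.BalabanUV.T4Continuum.VariationalCovariantUpperBound (mul_conj_of_norm_one)
open Summit.QuantumFields.BalabanUV.T4Continuum.VariationalTaxiTransport (plaq taxiT norm_taxiT inBlock_defect_taxiT_le)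
open Summit.QuantumFields.BalabanUV.T4Continuum.VariationalTaxiCoarse (coarseT norm_coarseT)
open Summit.QuantumFields.BalabanUV.T4Continuum.VariationalTaxiNested (plaq_Rtr norm_compT_rel_step step_le_of_class)
open Summit.QuantumFields.BalabanUV.T4Continuum.VariationalTaxiTower (plaq_coarseT_sub_one_le)
open Summit.QuantumFields.BalabanUV.T4Continuum.VariationalCovariantTwoRunsNE3 (fineOf)
open Summit.QuantumFields.BalabanUV.T4Continuum.VariationalCovariantTwoRunsTransport (pres Rtr_pres norm_pres nestOf nestOf_zero nestOf_succ norm_nestOf)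

variable {d : ℕ} (L : ℕ) [NeZero L] (M : Fin d → ℕ) [hM : ∀ μ, NeZero (M μ)]

/-! ## §1 Plaquettes of the one-step presentation -/

omit [NeZero L] hM in
/-- the plaquettes of the one-step presentation `pres R` are the level-`n·L` plaquettes of `R`. [folklore] -/
theorem plaq_pres (n : ℕ) [NeZero n] (R : Tor (fine (n * L) M) → Fin d → ℂ) (x' : Tor (fine L (fine n M))) (κ ν : Fin d) :
    plaq L (fine n M) (pres L M n R) x' κ ν = plaq (n * L) M R ((sites n L M).symm x') κ ν := by
  have h := plaq_Rtr n L M (pres L M n R) ((sites n L M).symm x') κ ν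
  rw [Equiv.apply_symm_apply, Rtr_pres] at h
  exact h.symm

omit [NeZero L] hM in
/-- the one-step presentation inherits the plaquette defect. [folklore] -/
theorem norm_plaq_pres_sub_one_le (n : ℕ) [NeZero n] {R : Tor (fine (n * L) M) → Fin d → ℂ} {a : ℝ}
    (ha : ∀ x κ ν, ‖plaq (n * L) M R x κ ν - 1‖ ≤ a) (x' : Tor (fine L (fine n M))) (κ ν : Fin d) :
    ‖plaq L (fine n M) (pres L M n R) x' κ ν - 1‖ ≤ a := by
  rw [plaq_pres]; exact ha _ κ ν

omit hM in
/-- along a tower of runs: run `k+1` presented over level `k` (`fineOf Rc k`) has the plaquette defect of `Rc (k+1)`. [folklore] -/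
theorem norm_plaq_fineOf_sub_one_le (Rc : (k : ℕ) → Tor (fine (L ^ k) M) → Fin d → ℂ) {p : ℕ → ℝ}
    (hp : ∀ k x κ ν, ‖plaq (L ^ k) M (Rc k) x κ ν - 1‖ ≤ p k) (k : ℕ) (x' : Tor (fine L (fine (L ^ k) M))) (κ ν : Fin d) :
    ‖plaq L (fine (L ^ k) M) (fineOf L M Rc k) x' κ ν - 1‖ ≤ p (k + 1) :=
  norm_plaq_pres_sub_one_le L M (L ^ k) (R := Rc (k + 1)) (hp (k + 1)) x' κ ν

omit [NeZero L] in
/-- the class line rewritten: `((L^k)·L)² = (L^{k+1})²` on the casts. [folklore] -/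
theorem lev_mul_L (k : ℕ) : (((L ^ k : ℕ)) : ℝ) * L = (((L ^ (k + 1) : ℕ)) : ℝ) := by push_cast; ring

/-! ## §2 The nested-vs-straight relative phase of `nestOf` -/

/-- **THE RELATIVE PHASE OF THE NESTED TAXI TRANSPORT OF A LEVEL-`k` CONNECTION, geometric form**: for unit phases `R` at level `k` with
plaquette defect `a` and the scale-invariant class `(L^k)²·a ≤ c` (`L ≥ 2`), `‖nestOf k R x·conj (taxiT (L^k) M R x) − 1‖ ≤ 4d²c·(1 − L^{−k})`
— induction over the nesting: the once-coarsened phases have defect `L²a` and the SAME class constant, the one-level step is leaf-01-g4's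
`norm_compT_rel_step` with `step ≤ 2d²c∕L^k`. [folklore] -/
theorem nestOf_hrel_geom (hL : 2 ≤ L) :
    ∀ (k : ℕ) {R : Tor (fine (L ^ k) M) → Fin d → ℂ}, (∀ x μ, ‖R x μ‖ = 1) → ∀ {a : ℝ}, 0 ≤ a →
      (∀ x κ ν, ‖plaq (L ^ k) M R x κ ν - 1‖ ≤ a) → ∀ {c : ℝ}, (((L ^ k : ℕ)) : ℝ) ^ 2 * a ≤ c →
        ∀ x, ‖nestOf L M k R x * conj (taxiT (L ^ k) M R x) - 1‖ ≤ 4 * (d : ℝ) ^ 2 * c * (1 - ((L : ℝ) ^ k)⁻¹)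
  | 0, R, hR1, a, _, _, c, _, x => by
    rw [nestOf_zero, (mul_conj_of_norm_one (norm_taxiT (L ^ 0) M hR1 x)).1, sub_self, norm_zero]
    simp
  | k + 1, R, hR1, a, ha0, ha, c, hclass, x => by
    have hL1 : (1 : ℝ) < L := by exact_mod_cast hL
    have hL0 : (0 : ℝ) < L := by linarith
    have hn : 1 ≤ L ^ k := Nat.one_le_pow k L (Nat.pos_of_ne_zero (NeZero.ne L))
    -- the one-step presentation and the once-coarsened phases
    have hp1 : ∀ x' μ, ‖pres L M (L ^ k) R x' μ‖ = 1 := norm_pres L M (L ^ k) hR1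
    have hpa : ∀ x' κ ν, ‖plaq L (fine (L ^ k) M) (pres L M (L ^ k) R) x' κ ν - 1‖ ≤ a :=
      norm_plaq_pres_sub_one_le L M (L ^ k) ha
    have hc1 : ∀ y μ, ‖coarseT L (fine (L ^ k) M) (pres L M (L ^ k) R) y μ‖ = 1 := norm_coarseT L (fine (L ^ k) M) hp1
    have hca : ∀ y κ ν, ‖plaq (L ^ k) M (coarseT L (fine (L ^ k) M) (pres L M (L ^ k) R)) y κ ν - 1‖ ≤ (L : ℝ) * L * a :=
      plaq_coarseT_sub_one_le L M hp1 hpa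
    have hclass' : ((((L ^ k : ℕ)) : ℝ) * L) ^ 2 * a ≤ c := by rw [lev_mul_L]; exact hclass
    have hclassc : (((L ^ k : ℕ)) : ℝ) ^ 2 * ((L : ℝ) * L * a) ≤ c := by
      have e : (((L ^ k : ℕ)) : ℝ) ^ 2 * ((L : ℝ) * L * a) = ((((L ^ k : ℕ)) : ℝ) * L) ^ 2 * a := by ring
      rw [e]; exact hclass'
    have hc0 : 0 ≤ c := le_trans (by positivity) hclass
    -- induction hypothesis on the coarsened phases, then the one-level step
    have ih := nestOf_hrel_geom hL k hc1 (by positivity) hca hclassc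
    have hstep := norm_compT_rel_step (L ^ k) L M hp1 hpa (norm_nestOf L M k hc1)
      (γ := 4 * (d : ℝ) ^ 2 * c * (1 - ((L : ℝ) ^ k)⁻¹)) ih x
    rw [Rtr_pres] at hstep
    have hsc := step_le_of_class d (L ^ k) L hn ha0 hclass'
    have e1 : (((L ^ k : ℕ) : ℝ)) = (L : ℝ) ^ k := by push_cast; ring
    rw [e1] at hsc
    rw [nestOf_succ]
    refine hstep.trans ?_
    have h2 : (L : ℝ)⁻¹ ≤ 1 / 2 := by
      rw [inv_le_comm₀ hL0 (by norm_num)]; norm_num; exact_mod_cast hL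
    have hinv : 0 ≤ ((L : ℝ) ^ k)⁻¹ := by positivity
    have hD : 0 ≤ (d : ℝ) ^ 2 * c := by positivity
    have epow : ((L : ℝ) ^ (k + 1))⁻¹ = ((L : ℝ) ^ k)⁻¹ * (L : ℝ)⁻¹ := by rw [pow_succ, mul_inv]
    have hkey : 2 * (d : ℝ) ^ 2 * c / (L : ℝ) ^ k ≤ 4 * (d : ℝ) ^ 2 * c * (((L : ℝ) ^ k)⁻¹ - ((L : ℝ) ^ (k + 1))⁻¹) := by
      rw [epow, div_eq_mul_inv]
      nlinarith [mul_nonneg (mul_nonneg hD hinv) (sub_nonneg.mpr h2)]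
    linarith

/-- **THE RELATIVE PHASE OF THE NESTED TAXI TRANSPORT, k-UNIFORM**: `‖nestOf k R x·conj (taxiT (L^k) M R x) − 1‖ ≤ 4d²·c` — the END's `hrel`
binder for BOTH runs of the two-runs tower (each run's transport against its own straight taxi), from its own plaquette class alone. [folklore] -/
theorem nestOf_hrel (hL : 2 ≤ L) (k : ℕ) {R : Tor (fine (L ^ k) M) → Fin d → ℂ} (hR1 : ∀ x μ, ‖R x μ‖ = 1) {a : ℝ} (ha0 : 0 ≤ a)
    (ha : ∀ x κ ν, ‖plaq (L ^ k) M R x κ ν - 1‖ ≤ a) {c : ℝ} (hclass : (((L ^ k : ℕ)) : ℝ) ^ 2 * a ≤ c) (x : Tor (fine (L ^ k) M)) :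
    ‖nestOf L M k R x * conj (taxiT (L ^ k) M R x) - 1‖ ≤ 4 * (d : ℝ) ^ 2 * c := by
  have hc0 : 0 ≤ c := le_trans (by positivity) hclass
  have hL1 : (1 : ℝ) ≤ (L : ℝ) ^ k := by exact_mod_cast Nat.one_le_pow k L (Nat.pos_of_ne_zero (NeZero.ne L))
  refine (nestOf_hrel_geom L M hL k hR1 ha0 ha hclass x).trans ?_
  have hinv : 0 ≤ ((L : ℝ) ^ k)⁻¹ := by positivity
  nlinarith [mul_nonneg (by positivity : (0 : ℝ) ≤ 4 * (d : ℝ) ^ 2 * c) hinv]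

/-- along a tower of runs: the relative phase of the COARSE PARTNER's nested transport (`Rb k = coarseT (fineOf Rc k)`, plaquette defect
`L²·p_{k+1}`, class constant unchanged). [folklore] -/
theorem nestOf_hrel_coarse (hL : 2 ≤ L) (Rc : (k : ℕ) → Tor (fine (L ^ k) M) → Fin d → ℂ) (hRc1 : ∀ k x μ, ‖Rc k x μ‖ = 1)
    {p : ℕ → ℝ} (hp0 : ∀ k, 0 ≤ p k) (hp : ∀ k x κ ν, ‖plaq (L ^ k) M (Rc k) x κ ν - 1‖ ≤ p k) {c : ℝ}
    (hclass : ∀ k, (((L ^ k : ℕ)) : ℝ) ^ 2 * p k ≤ c) (k : ℕ) (x : Tor (fine (L ^ k) M)) :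
    ‖nestOf L M k (coarseT L (fine (L ^ k) M) (fineOf L M Rc k)) x
        * conj (taxiT (L ^ k) M (coarseT L (fine (L ^ k) M) (fineOf L M Rc k)) x) - 1‖ ≤ 4 * (d : ℝ) ^ 2 * c := by
  have h1 : ∀ x' μ, ‖fineOf L M Rc k x' μ‖ = 1 := fun x' μ => hRc1 (k + 1) _ μ
  have ha := plaq_coarseT_sub_one_le L M h1 (norm_plaq_fineOf_sub_one_le L M Rc hp k)
  have hclassc : (((L ^ k : ℕ)) : ℝ) ^ 2 * ((L : ℝ) * L * p (k + 1)) ≤ c := by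
    have e : (((L ^ k : ℕ)) : ℝ) ^ 2 * ((L : ℝ) * L * p (k + 1)) = ((((L ^ k : ℕ)) : ℝ) * L) ^ 2 * p (k + 1) := by ring
    rw [e, lev_mul_L]; exact hclass (k + 1)
  exact nestOf_hrel L M hL k (norm_coarseT L (fine (L ^ k) M) h1) (by have := hp0 (k + 1); positivity) ha hclassc x

/-! ## §3 The run-`k` reference data at taxi data -/

section Run

variable (Rc : (k : ℕ) → Tor (fine (L ^ k) M) → Fin d → ℂ) (hRc1 : ∀ k x μ, ‖Rc k x μ‖ = 1)
variable {p : ℕ → ℝ} (hp0 : ∀ k, 0 ≤ p k) (hp : ∀ k x κ ν, ‖plaq (L ^ k) M (Rc k) x κ ν - 1‖ ≤ p k)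
variable {c : ℝ} (hclass : ∀ k, (((L ^ k : ℕ)) : ℝ) ^ 2 * p k ≤ c)
include hRc1 hp

/-- the in-block defect of run `k` against ITS OWN straight taxi: `w₀_k = (d−1)(L^k − 1)·p_k`. [folklore] -/
theorem hwin_run (k : ℕ) (y : Tor M) (j : Fin d → Fin (L ^ k)) (μ : Fin d) (h : (j μ : ℕ) + 1 < L ^ k) :
    ‖Rc k (bpt (L ^ k) M y j) μ * conj (taxiT (L ^ k) M (Rc k) (bpt (L ^ k) M y j + unitVec (fine (L ^ k) M) μ))
        * taxiT (L ^ k) M (Rc k) (bpt (L ^ k) M y j) - 1‖ ≤ ((d - 1 : ℕ) : ℝ) * ((L ^ k - 1 : ℕ) : ℝ) * p k :=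
  inBlock_defect_taxiT_le (L ^ k) M (hRc1 k) (hp k) y j μ h

include hp0 hclass
omit hM hRc1 hp in
/-- its class line: `n·w₀_k ≤ (d−1)c`. [folklore] -/
theorem n_mul_w₀_le (k : ℕ) :
    (((L ^ k : ℕ)) : ℝ) * (((d - 1 : ℕ) : ℝ) * ((L ^ k - 1 : ℕ) : ℝ) * p k) ≤ ((d - 1 : ℕ) : ℝ) * c := by
  have hn1 : 1 ≤ L ^ k := Nat.one_le_pow k L (Nat.pos_of_ne_zero (NeZero.ne L))
  have hn : ((L ^ k - 1 : ℕ) : ℝ) ≤ (((L ^ k : ℕ)) : ℝ) := by exact_mod_cast Nat.sub_le (L ^ k) 1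
  have h0 : (0 : ℝ) ≤ ((L ^ k - 1 : ℕ) : ℝ) := Nat.cast_nonneg _
  have hD : (0 : ℝ) ≤ ((d - 1 : ℕ) : ℝ) := Nat.cast_nonneg _
  calc (((L ^ k : ℕ)) : ℝ) * (((d - 1 : ℕ) : ℝ) * ((L ^ k - 1 : ℕ) : ℝ) * p k)
      = ((d - 1 : ℕ) : ℝ) * ((((L ^ k : ℕ)) : ℝ) * ((L ^ k - 1 : ℕ) : ℝ) * p k) := by ring
    _ ≤ ((d - 1 : ℕ) : ℝ) * ((((L ^ k : ℕ)) : ℝ) ^ 2 * p k) := by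
        refine mul_le_mul_of_nonneg_left ?_ hD
        have := hp0 k
        nlinarith [mul_le_mul_of_nonneg_left hn (Nat.cast_nonneg (L ^ k)), mul_nonneg (Nat.cast_nonneg (α := ℝ) (L ^ k)) h0]
    _ ≤ ((d - 1 : ℕ) : ℝ) * c := mul_le_mul_of_nonneg_left (hclass k) hD

omit hM hRc1 hp in
/-- the fictitious-defect line for run `k` with the SAME `w′_k = c_w′∕L^k`, `c_w′ = (4 + (d−1)c)∕(1−γ)` as the pair side
(leaf-04-g3's `hw'_taxiTower` shape). [folklore] -/
theorem hw'_run {γ : ℝ} (hγ : γ < 1) (k : ℕ) :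
    (4 + (((L ^ k : ℕ)) : ℝ) * (((d - 1 : ℕ) : ℝ) * ((L ^ k - 1 : ℕ) : ℝ) * p k)) / (1 - γ) - 1
      ≤ (((L ^ k : ℕ)) : ℝ) * ((4 + ((d - 1 : ℕ) : ℝ) * c) / (1 - γ) / (((L ^ k : ℕ)) : ℝ)) := by
  have hn : (0 : ℝ) < (((L ^ k : ℕ)) : ℝ) := by exact_mod_cast Nat.pos_of_ne_zero (NeZero.ne (L ^ k))
  have hγ' : 0 < 1 - γ := by linarith
  have hc0 : 0 ≤ c := le_trans (by have := hp0 0; positivity) (hclass 0)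
  have h1 := n_mul_w₀_le (d := d) L hp0 hclass k
  have hcw0 : 0 ≤ (4 + ((d - 1 : ℕ) : ℝ) * c) / (1 - γ) := by positivity
  rw [mul_div_cancel₀ _ hn.ne']
  have hmono : (4 + (((L ^ k : ℕ)) : ℝ) * (((d - 1 : ℕ) : ℝ) * ((L ^ k - 1 : ℕ) : ℝ) * p k)) / (1 - γ)
      ≤ (4 + ((d - 1 : ℕ) : ℝ) * c) / (1 - γ) := div_le_div_of_nonneg_right (by linarith) hγ'.le
  linarith

omit hM hRc1 hp in
/-- the per-block P⁺ smallness for run `k`: `2d((d−1)c)² + 4γ² ≤ ½ ⇒ 2d(n·w₀_k)² + 4γ² ≤ ½`. [folklore] -/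
theorem hsmall_run {γ : ℝ} (hc : 2 * (d : ℝ) * (((d - 1 : ℕ) : ℝ) * c) ^ 2 + 4 * γ ^ 2 ≤ 1 / 2) (k : ℕ) :
    2 * (d : ℝ) * ((((L ^ k : ℕ)) : ℝ) * (((d - 1 : ℕ) : ℝ) * ((L ^ k - 1 : ℕ) : ℝ) * p k)) ^ 2 + 4 * γ ^ 2 ≤ 1 / 2 := by
  have h := n_mul_w₀_le (d := d) L hp0 hclass k
  have h0 : 0 ≤ (((L ^ k : ℕ)) : ℝ) * (((d - 1 : ℕ) : ℝ) * ((L ^ k - 1 : ℕ) : ℝ) * p k) := by have := hp0 k; positivity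
  have hsq := pow_le_pow_left₀ h0 h 2
  nlinarith [Nat.cast_nonneg (α := ℝ) d]

end Run

end Summit.QuantumFields.BalabanUV.T4Continuum.VariationalCovariantTwoRunsNestRel

end
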